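import Summits.CriticalPhenomena.PercolationContinuityZ3.Theorems.Transplant.PlanarCells2Defs
import HarnessLib

/-!
# Two-unit planar cells `PCells2` (layer L1′ of route D″ v2), part 2: containments — cubes, cells, between-boxes, stubs, faces, the corridor,
# the far rows, narrow ⊆ wide (the planar halves of the fields of `SepGeom` / `ExitGeom` / `RunGeom` / `StepsGeom`, two units)

builds on p205010 (kernel theorem, internal audit signed; external expert review pending) — nothing in this file uses p205010.
Lane `prim-bschramm`, seat `prim-hp-8` (gen 27; `HOME/bschramm/DPRIME-SCOPE.md` §2 L1′, lead VERDICT V98); helper file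
(`--supports stmt-CriticalPhenomena-4575 --as helper`).  Continues `PlanarCells2Defs`; every proof is the one-unit proof of
`PlanarCellsDefs` / `PlanarCellsFaces` / `PlanarCellsNarrowDefs` with the level unit `r (δ.1)` and the transverse unit `r (oth δ.1)`.
* `M ⊆ Q ⊆ Cell`, `cen x ∈ Q_x`, `cen x ∈ M_x`, `0 ∈ Q_0`; `Btw ⊆ Cell ∪ Cell'`, `Stub ⊆ Q ∪ Btw`, `Stub ⊆ Q ∪ BtwN`, `Stub ⊆ Cell ∪ Zone` (`j < K`),
  `Efar ⊆ Btw ∪ Q'`, `EfarN ⊆ BtwN ∪ Q'`; `Face ⊆ Stub`, `Stub ⊆ Hfull` (`j ≤ K`), `Hfull ⊆ Q ∪ Efar`, `Hfull ⊆ Q ∪ EfarN`;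
  `M_{v+δ} ⊆ Efar / EfarN / farAS`; `BtwN ⊆ Btw ⊆ Efar`, `EfarN ⊆ Efar`, `EwvN ⊆ Ewv`, `BtwN ⊆ EfarN`, `farAS ⊆ farAN ⊆ EfarN`, `BtwN ⊆ Cell ∪ Cell'`,
  `Stub_mono`, `stub_top_le`.
[cite: KozmaNitzan2024, §4 pp. 25–26 (Q_v, M_v, E_{v,x}, H^j_{v,x}), p. 30 (F^j_{v,x}) — the ℤ^d model, one unit]
-/

noncomputable section

namespace Summit.CriticalPhenomena.PercolationContinuityZ3.Theorems

namespace Transplant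

open Literature.Probability.Percolation Literature.Probability.LatticeModels SimpleGraph GadgetSystem Contour
open Literature.Probability.Percolation.KozmaNitzan
open Literature.Probability.Percolation.KozmaNitzan.Cells (oth oth_ne sgOf sgOf_sign stepVec_apply_fst stepVec_apply_oth eq_oth_of_ne oth_oth
  eq_of_coords)
open PCells (mem_psBox_iff)

namespace PCells2

variable (P : PCells2)

/-! ## Containments: cubes, cells, between-boxes, stubs -/

/-- `M_v ⊆ Q_v`. [folklore] -/
theorem M_subset_Q (v : Site 2) : P.M v ⊆ P.Q v := by
  intro t ht
  rw [M, mem_abox_iff] at ht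
  rw [Q, mem_abox_iff]
  intro i; have := ht i; push_cast at this ⊢; constructor <;> omega

/-- `Q_v ⊆ Cell_v`. [folklore] -/
theorem Q_subset_Cell (v : Site 2) : (P.Q v : Finset (Site 2)) ⊆ P.Cell v := by
  intro t ht
  rw [Q, mem_abox_iff] at ht
  rw [Cell, mem_abox_iff]
  intro i; have := ht i; push_cast at this ⊢; constructor <;> omega

/-- The centre of `x` lies in `Q_x`. [folklore] -/
theorem cen_mem_Q (x : Site 2) : P.cen x ∈ P.Q x := by
  rw [Q, mem_abox_iff]; intro i; push_cast; constructor <;> omega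

/-- The centre of `x` lies in `M_x`. [folklore] -/
theorem cen_mem_M (x : Site 2) : P.cen x ∈ P.M x := by
  rw [M, mem_abox_iff]; intro i; push_cast; constructor <;> omega

/-- `0 ∈ Q_0`. [folklore] -/
theorem zero_mem_Q_zero : (0 : Site 2) ∈ P.Q 0 := by
  have h := P.cen_mem_Q 0
  rwa [cen_zero] at h

/-- `Btw_{v,δ} ⊆ Cell_v ∪ Cell_{v+δ}`. [folklore] -/
theorem Btw_subset_Cells (v : Site 2) (δ : MDir) : P.Btw v δ ⊆ P.Cell v ∪ P.Cell (v + stepVec δ) := by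
  intro t ht
  rw [Btw, mem_psBox_iff] at ht
  obtain ⟨⟨h1, h2⟩, h3, h4⟩ := ht
  rw [Finset.mem_union, Cell, Cell, mem_abox_iff, mem_abox_iff]
  have hf := P.cen_add_stepVec_fst v δ
  have ho := P.cen_add_stepVec_oth v δ
  by_cases hlev : sgOf δ * (t δ.1 - P.cen v δ.1) ≤ 10 * P.r δ.1
  · left
    intro i
    rcases eq_or_ne i δ.1 with rfl | hi
    · rcases sgOf_sign δ with hs | hs <;> rw [hs] at h1 h2 hlev <;> push_cast <;> constructor <;> omega
    · rw [eq_oth_of_ne hi]; push_cast; constructor <;> omega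
  · right
    intro i
    rcases eq_or_ne i δ.1 with rfl | hi
    · rw [hf]
      rcases sgOf_sign δ with hs | hs <;> rw [hs] at h1 h2 hlev ⊢ <;> push_cast <;> constructor <;> omega
    · rw [eq_oth_of_ne hi, ho]; push_cast; constructor <;> omega

/-- `10 s∥ j ≤ 10 r∥ − 10 s∥` for `j < K`. [folklore] -/
theorem ten_s_mul_le_of_lt {a : Fin 2} {j : ℕ} (hj : j < P.K) : 10 * (P.s a : ℤ) * j ≤ 10 * P.r a - 10 * P.s a := by
  have : P.s a * (j + 1) ≤ P.s a * P.K := Nat.mul_le_mul_left _ (by omega)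
  have hr := P.r_eq a
  nlinarith

/-- `H^j ⊆ Q_v ∪ Btw` for `j + 1 ≤ K`. [folklore] -/
theorem Stub_subset_Q_union_Btw (v : Site 2) (δ : MDir) {j : ℕ} (hj : j < P.K) : (P.Stub v δ j : Finset (Site 2)) ⊆ P.Q v ∪ P.Btw v δ := by
  intro t ht
  rw [Stub, mem_psBox_iff] at ht
  obtain ⟨⟨h1, h2⟩, h3, h4⟩ := ht
  have hsj := P.ten_s_mul_le_of_lt (a := δ.1) hj
  have hs1 := P.hs δ.1
  rw [Finset.mem_union, Q, mem_abox_iff, Btw, mem_psBox_iff]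
  by_cases hlev : sgOf δ * (t δ.1 - P.cen v δ.1) ≤ 5 * P.r δ.1
  · left
    intro i
    rcases eq_or_ne i δ.1 with rfl | hi
    · rcases sgOf_sign δ with hs | hs <;> rw [hs] at h1 hlev <;> push_cast <;> constructor <;> omega
    · rw [eq_oth_of_ne hi]; push_cast; constructor <;> omega
  · right
    refine ⟨⟨by omega, by omega⟩, by omega, by omega⟩

/-- `H^j ⊆ Q_v ∪ BtwN` for `j + 1 ≤ K` (the stub has transverse half-width `2r⊥ ≤ 5r⊥ − 1`). [folklore] -/
theorem Stub_subset_Q_union_BtwN (v : Site 2) (δ : MDir) {j : ℕ} (hj : j < P.K) : (P.Stub v δ j : Finset (Site 2)) ⊆ P.Q v ∪ P.BtwN v δ := by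
  intro t ht
  rw [Stub, mem_psBox_iff] at ht
  obtain ⟨⟨h1, h2⟩, h3, h4⟩ := ht
  have hsj := P.ten_s_mul_le_of_lt (a := δ.1) hj
  have hs1 := P.hs δ.1
  have hr1 := P.one_le_r (oth δ.1)
  rw [Finset.mem_union, Q, mem_abox_iff, BtwN, mem_psBox_iff]
  by_cases hlev : sgOf δ * (t δ.1 - P.cen v δ.1) ≤ 5 * P.r δ.1
  · left
    intro i
    rcases eq_or_ne i δ.1 with rfl | hi
    · rcases sgOf_sign δ with hs | hs <;> rw [hs] at h1 hlev <;> push_cast <;> constructor <;> omega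
    · rw [eq_oth_of_ne hi]; push_cast; constructor <;> omega
  · right
    refine ⟨⟨by omega, by omega⟩, by omega, by omega⟩

/-- `H^j ⊆ Cell_v ∪ Zone` for `j + 1 ≤ K`. [folklore] -/
theorem Stub_subset_Cell_union_Zone (v : Site 2) (δ : MDir) {j : ℕ} (hj : j < P.K) :
    (P.Stub v δ j : Finset (Site 2)) ⊆ P.Cell v ∪ P.Zone v δ := by
  intro t ht
  rw [Stub, mem_psBox_iff] at ht
  obtain ⟨⟨h1, h2⟩, h3, h4⟩ := ht
  have hsj := P.ten_s_mul_le_of_lt (a := δ.1) hj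
  rw [Finset.mem_union, Cell, mem_abox_iff, Zone, mem_psBox_iff]
  by_cases hlev : sgOf δ * (t δ.1 - P.cen v δ.1) ≤ 10 * P.r δ.1
  · left
    intro i
    rcases eq_or_ne i δ.1 with rfl | hi
    · rcases sgOf_sign δ with hs | hs <;> rw [hs] at h1 hlev <;> push_cast <;> constructor <;> omega
    · rw [eq_oth_of_ne hi]; push_cast; constructor <;> omega
  · right
    refine ⟨⟨by omega, by omega⟩, by omega, by omega⟩

/-- `E^far ⊆ Btw ∪ Q_{v+δ}`. [folklore] -/
theorem Efar_subset_Btw_union_Q (v : Site 2) (δ : MDir) : (P.Efar v δ : Finset (Site 2)) ⊆ P.Btw v δ ∪ P.Q (v + stepVec δ) := by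
  intro t ht
  rw [Efar, mem_psBox_iff] at ht
  obtain ⟨⟨h1, h2⟩, h3, h4⟩ := ht
  rw [Finset.mem_union, Btw, mem_psBox_iff, Q, mem_abox_iff]
  by_cases hlev : sgOf δ * (t δ.1 - P.cen v δ.1) ≤ 15 * P.r δ.1 - 1
  · left
    exact ⟨⟨by omega, by omega⟩, by omega, by omega⟩
  · right
    have hf := P.cen_add_stepVec_fst v δ
    have ho := P.cen_add_stepVec_oth v δ
    intro i
    rcases eq_or_ne i δ.1 with rfl | hi
    · rw [hf]
      rcases sgOf_sign δ with hs | hs <;> rw [hs] at h2 hlev ⊢ <;> push_cast at h2 ⊢ <;> constructor <;> omega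
    · rw [eq_oth_of_ne hi, ho]; push_cast at h3 h4 ⊢; constructor <;> omega

/-- `EfarN ⊆ BtwN ∪ Q_{v+δ}`. [folklore] -/
theorem EfarN_subset_BtwN_union_Q (v : Site 2) (δ : MDir) : (P.EfarN v δ : Finset (Site 2)) ⊆ P.BtwN v δ ∪ P.Q (v + stepVec δ) := by
  intro t ht
  rw [EfarN, mem_psBox_iff] at ht
  obtain ⟨⟨h1, h2⟩, h3, h4⟩ := ht
  rw [Finset.mem_union, BtwN, mem_psBox_iff, Q, mem_abox_iff]
  by_cases hlev : sgOf δ * (t δ.1 - P.cen v δ.1) ≤ 15 * P.r δ.1 - 1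
  · left
    exact ⟨⟨by omega, by omega⟩, by omega, by omega⟩
  · right
    have hf := P.cen_add_stepVec_fst v δ
    have ho := P.cen_add_stepVec_oth v δ
    intro i
    rcases eq_or_ne i δ.1 with rfl | hi
    · rw [hf]
      rcases sgOf_sign δ with hs | hs <;> rw [hs] at h2 hlev ⊢ <;> push_cast at h2 ⊢ <;> constructor <;> omega
    · rw [eq_oth_of_ne hi, ho]; push_cast at h3 h4 ⊢; constructor <;> omega

/-! ## Containments: faces, corridor, far rows -/

/-- The face of level `j` lies in the stub of level `j`. [folklore] -/
theorem Face_subset_Stub (v : Site 2) (δ : MDir) (j : ℕ) : (P.Face v δ j : Finset (Site 2)) ⊆ P.Stub v δ j := by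
  intro t ht
  rw [Face, mem_psBox_iff] at ht
  rw [Stub, mem_psBox_iff]
  obtain ⟨⟨h1, h2⟩, h3, h4⟩ := ht
  have : (0 : ℤ) ≤ 10 * P.s δ.1 * j := by positivity
  exact ⟨⟨by omega, h2⟩, h3, h4⟩

/-- Stubs of level `≤ K` lie in the full corridor (`10 s∥ K = 10 r∥`). [folklore] -/
theorem Stub_subset_Hfull (v : Site 2) (δ : MDir) {j : ℕ} (hj : j ≤ P.K) : (P.Stub v δ j : Finset (Site 2)) ⊆ P.Hfull v δ := by
  intro t ht
  rw [Stub, mem_psBox_iff] at ht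
  rw [Hfull, mem_psBox_iff]
  obtain ⟨⟨h1, h2⟩, h3, h4⟩ := ht
  have hsj := P.s_mul_le_r (i := δ.1) hj
  exact ⟨⟨h1, by nlinarith⟩, h3, h4⟩

/-- The full corridor lies in `Q_v ∪ E^far_{v,x}`. [folklore] -/
theorem Hfull_subset_Q_union_Efar (v : Site 2) (δ : MDir) : (P.Hfull v δ : Finset (Site 2)) ⊆ P.Q v ∪ P.Efar v δ := by
  intro t ht
  rw [Hfull, mem_psBox_iff] at ht
  obtain ⟨⟨h1, h2⟩, h3, h4⟩ := ht
  rw [Finset.mem_union, Q, mem_abox_iff, Efar, mem_psBox_iff]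
  by_cases hlev : sgOf δ * (t δ.1 - P.cen v δ.1) ≤ 5 * P.r δ.1
  · left
    intro i
    rcases eq_or_ne i δ.1 with rfl | hi
    · rcases sgOf_sign δ with hs | hs <;> rw [hs] at h1 hlev <;> push_cast <;> constructor <;> omega
    · rw [eq_oth_of_ne hi]; push_cast; constructor <;> omega
  · right
    exact ⟨⟨by omega, by omega⟩, by omega, by omega⟩

/-- The full corridor lies in `Q_v ∪ EfarN_{v,x}` (corridor half-width `2r⊥ ≤ 5r⊥ − 1`). [folklore] -/
theorem Hfull_subset_Q_union_EfarN (v : Site 2) (δ : MDir) : (P.Hfull v δ : Finset (Site 2)) ⊆ P.Q v ∪ P.EfarN v δ := by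
  intro t ht
  rw [Hfull, mem_psBox_iff] at ht
  obtain ⟨⟨h1, h2⟩, h3, h4⟩ := ht
  have hr1 := P.one_le_r (oth δ.1)
  rw [Finset.mem_union, Q, mem_abox_iff, EfarN, mem_psBox_iff]
  by_cases hlev : sgOf δ * (t δ.1 - P.cen v δ.1) ≤ 5 * P.r δ.1
  · left
    intro i
    rcases eq_or_ne i δ.1 with rfl | hi
    · rcases sgOf_sign δ with hs | hs <;> rw [hs] at h1 hlev <;> push_cast <;> constructor <;> omega
    · rw [eq_oth_of_ne hi]; push_cast; constructor <;> omega
  · right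
    exact ⟨⟨by omega, by omega⟩, by omega, by omega⟩

/-- The target cube lies in the far region: `M_{v+δ} ⊆ E^far_{v,δ}`. [folklore] -/
theorem M_add_stepVec_subset_Efar (v : Site 2) (δ : MDir) : (P.M (v + stepVec δ) : Finset (Site 2)) ⊆ P.Efar v δ := by
  intro t ht
  rw [M, mem_abox_iff] at ht
  rw [Efar, mem_psBox_iff]
  have hf := P.cen_add_stepVec_fst v δ
  have ho := P.cen_add_stepVec_oth v δ
  have ha := ht δ.1
  have hb := ht (oth δ.1)
  rw [hf] at ha
  rw [ho] at hb
  push_cast at ha hb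
  have hr : (1 : ℤ) ≤ P.r δ.1 := by exact_mod_cast P.one_le_r δ.1
  refine ⟨?_, by omega, by omega⟩
  rcases sgOf_sign δ with hs | hs <;> rw [hs] at ha ⊢ <;> constructor <;> omega

/-- `M_{v+δ} ⊆ EfarN_{v,δ}` (`3r⊥ ≤ 5r⊥ − 1`). [folklore] -/
theorem M_add_stepVec_subset_EfarN (v : Site 2) (δ : MDir) : (P.M (v + stepVec δ) : Finset (Site 2)) ⊆ P.EfarN v δ := by
  intro t ht
  rw [M, mem_abox_iff] at ht
  rw [EfarN, mem_psBox_iff]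
  have hf := P.cen_add_stepVec_fst v δ
  have ho := P.cen_add_stepVec_oth v δ
  have ha := ht δ.1
  have hb := ht (oth δ.1)
  rw [hf] at ha
  rw [ho] at hb
  push_cast at ha hb
  have hr : (1 : ℤ) ≤ P.r δ.1 := by exact_mod_cast P.one_le_r δ.1
  have hr' : (1 : ℤ) ≤ P.r (oth δ.1) := by exact_mod_cast P.one_le_r (oth δ.1)
  refine ⟨?_, by omega, by omega⟩
  rcases sgOf_sign δ with hs | hs <;> rw [hs] at ha ⊢ <;> constructor <;> omega

/-- **`M(x + du) ⊆ farAS x du j`** for `j ≤ K` (levels `17r∥ … 23r∥`, transversally `3r⊥ ≤ 5r⊥ − 2`). [cite: KozmaNitzan2024, §4 p. 26 (M_x)] -/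
theorem M_add_stepVec_subset_farAS (x : Site 2) (du : MDir) {j : ℕ} (hj : j ≤ P.K) : P.M (x + stepVec du) ⊆ P.farAS x du j := by
  intro t ht
  rw [M, mem_abox_iff] at ht
  rw [farAS, mem_psBox_iff]
  have h1 := ht du.1
  have h2 := ht (oth du.1)
  rw [P.cen_add_stepVec_fst] at h1
  rw [P.cen_add_stepVec_oth] at h2
  have hsj := P.s_mul_le_r (i := du.1) hj
  have hr : (1 : ℤ) ≤ P.r du.1 := by exact_mod_cast P.one_le_r du.1
  have hr' : (1 : ℤ) ≤ P.r (oth du.1) := by exact_mod_cast P.one_le_r (oth du.1)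
  push_cast at h1 h2 ⊢
  refine ⟨?_, by constructor <;> linarith [h2.1, h2.2]⟩
  rcases sgOf_sign du with hs | hs <;> rw [hs] at h1 ⊢ <;> constructor <;> nlinarith [h1.1, h1.2]

/-! ## Narrow ⊆ wide, monotonicity -/

/-- `BtwN ⊆ Btw`. [folklore] -/
theorem BtwN_subset_Btw (v : Site 2) (δ : MDir) : P.BtwN v δ ⊆ P.Btw v δ :=
  sBox_mono (sgOf_sign δ) _ le_rfl le_rfl (by omega)

/-- `EfarN ⊆ Efar`. [folklore] -/
theorem EfarN_subset_Efar (v : Site 2) (δ : MDir) : P.EfarN v δ ⊆ P.Efar v δ :=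
  sBox_mono (sgOf_sign δ) _ le_rfl le_rfl (by omega)

/-- `EwvN ⊆ Ewv`. [folklore] -/
theorem EwvN_subset_Ewv (v : Site 2) (δ : MDir) : P.EwvN v δ ⊆ P.Ewv v δ :=
  Finset.union_subset_union (P.BtwN_subset_Btw v δ) le_rfl

/-- `Btw ⊆ Efar`. [folklore] -/
theorem Btw_subset_Efar (v : Site 2) (δ : MDir) : P.Btw v δ ⊆ P.Efar v δ :=
  sBox_mono (sgOf_sign δ) _ le_rfl (by have := P.one_le_r δ.1; omega) le_rfl

/-- `BtwN ⊆ EfarN`. [folklore] -/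
theorem BtwN_subset_EfarN (v : Site 2) (δ : MDir) : P.BtwN v δ ⊆ P.EfarN v δ :=
  sBox_mono (sgOf_sign δ) _ le_rfl (by have := P.one_le_r δ.1; omega) le_rfl

/-- `BtwN ⊆ Efar`. [folklore] -/
theorem BtwN_subset_Efar (v : Site 2) (δ : MDir) : P.BtwN v δ ⊆ P.Efar v δ :=
  (P.BtwN_subset_EfarN v δ).trans (P.EfarN_subset_Efar v δ)

/-- `farAN ⊆ EfarN`. [folklore] -/
theorem farAN_subset_EfarN (x : Site 2) (du : MDir) (j : ℕ) : P.farAN x du j ⊆ P.EfarN x du := by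
  refine sBox_mono (sgOf_sign du) _ ?_ le_rfl le_rfl
  nlinarith [P.hs du.1, Nat.zero_le j]

/-- `farAS ⊆ farAN`. [folklore] -/
theorem farAS_subset_farAN (x : Site 2) (du : MDir) (j : ℕ) : P.farAS x du j ⊆ P.farAN x du j :=
  sBox_mono (sgOf_sign du) _ (by omega) (by omega) (by omega)

/-- `farAS ⊆ EfarN`. [folklore] -/
theorem farAS_subset_EfarN (x : Site 2) (du : MDir) (j : ℕ) : P.farAS x du j ⊆ P.EfarN x du :=
  (P.farAS_subset_farAN x du j).trans (P.farAN_subset_EfarN x du j)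

/-- `BtwN_{v,δ} ⊆ Cell_v ∪ Cell_{v+δ}`. [folklore] -/
theorem BtwN_subset_Cells (v : Site 2) (δ : MDir) : P.BtwN v δ ⊆ P.Cell v ∪ P.Cell (v + stepVec δ) :=
  (P.BtwN_subset_Btw v δ).trans (P.Btw_subset_Cells v δ)

/-- The stubs grow with the level. [folklore] -/
theorem Stub_mono (v : Site 2) (δ : MDir) {j j' : ℕ} (h : j ≤ j') : (P.Stub v δ j : Finset (Site 2)) ⊆ P.Stub v δ j' := by
  intro t ht
  rw [Stub, mem_psBox_iff] at ht ⊢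
  obtain ⟨⟨h1, h2⟩, h3, h4⟩ := ht
  have : 10 * (P.s δ.1 : ℤ) * j ≤ 10 * P.s δ.1 * j' := by
    have : (j : ℤ) ≤ j' := by exact_mod_cast h
    nlinarith
  exact ⟨⟨h1, by omega⟩, h3, h4⟩

/-- The full stub of level `K` ends at level `15 r∥` (`10 s∥ K = 10 r∥`). [folklore] -/
theorem stub_top_le (δ : MDir) {j : ℕ} (hj : j ≤ P.K) : 5 * P.r δ.1 + 10 * P.s δ.1 * j ≤ 15 * P.r δ.1 := by
  unfold r
  have : P.s δ.1 * j ≤ P.s δ.1 * P.K := Nat.mul_le_mul_left _ hj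
  nlinarith

/-- **`M(x + du) ⊆ farAN x du j`** for `j ≤ K` (through the shrunk far rows `farAS`). [cite: KozmaNitzan2024, §4 p. 26 (M_x)] -/
theorem M_add_stepVec_subset_farAN (x : Site 2) (du : MDir) {j : ℕ} (hj : j ≤ P.K) : P.M (x + stepVec du) ⊆ P.farAN x du j :=
  (P.M_add_stepVec_subset_farAS x du hj).trans (P.farAS_subset_farAN x du j)

end PCells2

end Transplant

end Summit.CriticalPhenomena.PercolationContinuityZ3.Theorems

end
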